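import Summits.AnomalousDissipation.AnomalousDissipation.Theorems.BaireTransferRobustLoudUpgradeStubLsFamilyPeriodicB
import Literature.Analysis.FluidPDE.TimePeriodicNSLatticeLinearForced

/-!
# Stub `stub_lsFamilyPeriodic` (crux stmt-AnomalousDissipation-1144, companion c3), part C: RANGE TRANSFER through the forced linear
# dictionary (`forced_classical`: a lattice solution of `τ⁻¹∂ₛh + L₀h + B(x₀,h) + B(h,x₀) = Y_H − μ ∂ₛx₀` unrolls to a classical
# `τ`-periodic solution of the linearised problem forced by `(−μτ)∂ₜu + H`; `yf_eq_constField`: a steady force as a space–time field);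
# registered ending `lsFamilyPeriodic_partC` (compactness of the bordered free-period linearisation, abstract).  Pure proof file; local
# notations verbatim from `PeriodicNSOrbitPersistsProofs`.  References: Iooss 1972 §3; Henry 1981 Lemma 8.3.1; Chow–Hale 1982 §2.4.
-/


-- `Summit.<Summit>.<Problem>` is the tree's mandated summit-side namespace (CONVENTIONS §2); for this
-- single-conjunct summit the two coincide, so the duplicate is deliberate.
set_option linter.dupNamespace false

noncomputable section

open scoped BigOperators Topology ENNReal NNReal ComplexConjugate
open Filter Set Function MeasureTheory UnitAddTorus

namespace Summit.AnomalousDissipation.AnomalousDissipation.Theorems.RobustLoudUpgrade.LsFamilyPeriodic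

open Literature.Analysis.FunctionSpaces Literature.Analysis.FunctionSpaces.Torus
open Literature.Analysis.FunctionSpaces.EuclideanSpace
open Literature.Analysis.FluidPDE
open Literature.Analysis.FluidPDE.ScalarFourier
open Literature.Analysis.FluidPDE.TimePeriodicLattice
open Summit.AnomalousDissipation.AnomalousDissipation.Theses.BaireTransfer

-- NOTATION START (verbatim from `PeriodicNSOrbitPersistsProofs`)
/-- Local notation: the parabolic weight `Λ(n, k) = |n| + |k|²`. -/
local notation:max "Λ" m:max => (|((Prod.fst m : ℤ) : ℝ)| + freqNormSq (Prod.snd m))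

/-- Local notation: the convective symbol on `ℤ × ℤ³` (as in `TimePeriodicNSLattice`). -/
local notation:max "𝐍[" a ", " b "]" m:max =>
  (WithLp.toLp 2 (fun p : Fin 3 => ∑ j : Fin 3, ∑' m' : ℤ × (Fin 3 → ℤ),
    a m' j * (dsym j (Prod.snd m - Prod.snd m') * b (m - m') p)) : EuclideanSpace ℂ (Fin 3))

/-- Local notation: division by the weight. -/
local notation:max "𝐜" x:max => (fun mm : ℤ × (Fin 3 → ℤ) =>
  ((((|((Prod.fst mm : ℤ) : ℝ)| + freqNormSq (Prod.snd mm))⁻¹ : ℝ) : ℂ) • x mm))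

/-- Local notation: multiplication by the weight. -/
local notation:max "𝐬" x:max => (fun mm : ℤ × (Fin 3 → ℤ) =>
  ((((|((Prod.fst mm : ℤ) : ℝ)| + freqNormSq (Prod.snd mm)) : ℝ) : ℂ) • x mm))

/-- Local notation: the family of coefficients of `x ∈ W ⊂ ℓ²`. -/
local notation:max "𝐰" x:max =>
  (((x : lp (fun _ : ℤ × (Fin 3 → ℤ) => EuclideanSpace ℂ (Fin 3)) 2)) : ℤ × (Fin 3 → ℤ) → EuclideanSpace ℂ (Fin 3))

/-- Local notation: the extension `K ↦ c (K₀, tail K)` of a lattice family to `ℤ⁴`. -/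
local notation:max "𝐄" c:max => (fun K : Fin 4 → ℤ => c ((K 0, Fin.tail K) : ℤ × (Fin 3 → ℤ)))

/-- Local notation: the lattice family `û(n,k) = 𝓕(complexify ∘ (U − m₀))(n,k)`. -/
local notation:max "𝐮[" U ", " m₀ "]" => (fun mm : ℤ × (Fin 3 → ℤ) =>
  mFourierCoeff (EuclideanSpace.complexify ∘ fun y : UnitAddTorus (Fin 4) => U y - m₀)
    (Fin.cons (Prod.fst mm) (Prod.snd mm) : Fin 4 → ℤ))

/-- Local notation: the force family `y_F(n,k) = [k ≠ 0][n = 0] 𝓕(complexify ∘ F)(k)`. -/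
local notation:max "𝐲" F:max => (fun mm : ℤ × (Fin 3 → ℤ) =>
  (ite (Prod.snd mm = 0) (0 : EuclideanSpace ℂ (Fin 3))
    (ite (Prod.fst mm = 0) (mFourierCoeff (EuclideanSpace.complexify ∘ F) (Prod.snd mm)) 0)))

/-- Local notation: the lattice family of the orbit `u` with period `τ`. -/
local notation:max "𝐨[" τ ", " u "]" => (fun mm : ℤ × (Fin 3 → ℤ) =>
  mFourierCoeff (EuclideanSpace.complexify ∘ fun y : UnitAddTorus (Fin 4) => Torus.timeRoll τ u y - ∫ x, u 0 x)
    (Fin.cons (Prod.fst mm) (Prod.snd mm) : Fin 4 → ℤ))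
/-- Local notation: the time multiplier `dₛ(n,k) = 2πi n / Λ(n,k)`. -/
local notation "dS" => (fun mm : ℤ × (Fin 3 → ℤ) =>
  (2 * Real.pi * Complex.I * ((Prod.fst mm : ℤ) : ℂ)) * ((((|((Prod.fst mm : ℤ) : ℝ)| + freqNormSq (Prod.snd mm)) : ℝ) : ℂ))⁻¹)

/-- Local notation: the Stokes–drift multiplier `(4π²ν|k|² + 2πi m₀·k) / Λ(n,k)`. -/
local notation "dL[" ν ", " m₀ "]" => (fun mm : ℤ × (Fin 3 → ℤ) =>
  (((4 * Real.pi ^ 2 * ν * freqNormSq (Prod.snd mm) : ℝ) : ℂ) +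
      2 * Real.pi * Complex.I * (∑ jj : Fin 3, ((m₀ jj : ℝ) : ℂ) * (((Prod.snd mm) jj : ℤ) : ℂ))) *
    ((((|((Prod.fst mm : ℤ) : ℝ)| + freqNormSq (Prod.snd mm)) : ℝ) : ℂ))⁻¹)

/-- Local notation: the symbol `σ_om(n,k) = 2πiomn + 4π²ν|k|² + 2πi m₀·k`. -/
local notation "σ[" om ", " ν ", " m₀ "]" => (fun mm : ℤ × (Fin 3 → ℤ) =>
  2 * Real.pi * Complex.I * ((om : ℝ) : ℂ) * ((Prod.fst mm : ℤ) : ℂ) +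
    (((4 * Real.pi ^ 2 * ν * freqNormSq (Prod.snd mm) : ℝ)) : ℂ) +
    2 * Real.pi * Complex.I * (∑ jj : Fin 3, ((m₀ jj : ℝ) : ℂ) * (((Prod.snd mm) jj : ℤ) : ℂ)))
-- NOTATION END

variable {W : Submodule ℝ (lp (fun _ : ℤ × (Fin 3 → ℤ) => EuclideanSpace ℂ (Fin 3)) 2)}

/-! ## §5 Range transfer: lattice solutions of the FORCED linearisation are classical forced periodic solutions -/

section Forced

variable {ν τ : ℝ} {f : UnitAddTorus (Fin 3) → EuclideanSpace ℝ (Fin 3)}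
  {u : ℝ → UnitAddTorus (Fin 3) → EuclideanSpace ℝ (Fin 3)} {p : ℝ → UnitAddTorus (Fin 3) → ℝ}

variable (hW : ∀ x : lp (fun _ : ℤ × (Fin 3 → ℤ) => EuclideanSpace ℂ (Fin 3)) 2, x ∈ W ↔
      (∀ n : ℤ, (x : ℤ × (Fin 3 → ℤ) → EuclideanSpace ℂ (Fin 3)) (n, 0) = 0) ∧
      (∀ mm : ℤ × (Fin 3 → ℤ), (∑ jj : Fin 3, ((mm.2 jj : ℤ) : ℂ) *
        ((x : ℤ × (Fin 3 → ℤ) → EuclideanSpace ℂ (Fin 3)) mm) jj) = 0) ∧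
      (∀ mm : ℤ × (Fin 3 → ℤ), (x : ℤ × (Fin 3 → ℤ) → EuclideanSpace ℂ (Fin 3)) (-mm) =
        conjVec ((x : ℤ × (Fin 3 → ℤ) → EuclideanSpace ℂ (Fin 3)) mm)))
variable {Ds L₀ : W →L[ℝ] W} (hDs : ∀ (x : W) (m : ℤ × (Fin 3 → ℤ)), (𝐰 (Ds x)) m = dS m • (𝐰 x) m)
  (hL₀ : ∀ (x : W) (m : ℤ × (Fin 3 → ℤ)), (𝐰 (L₀ x)) m = dL[ν, ∫ x, u 0 x] m • (𝐰 x) m)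
variable {B : W → W → W} (hBf : ∀ (x y : W) (m : ℤ × (Fin 3 → ℤ)), (𝐰 (B x y)) m = Torus.lerayCoeff m.2 (𝐍[𝐜 (𝐰 x), 𝐜 (𝐰 y)] m))

include hW hDs hL₀ hBf in
/-- **Range transfer** (the forced linear dictionary `linear_core_forced` / `linear_rolledUp_of_coeff_forced` /
`linear_classical_forced`, assembled): for a real admissible `τ`-periodic space–time field `H` with lattice vector
`Y_H = Ĥ`, every lattice solution `h ∈ W` of `τ⁻¹∂ₛh + L₀h + B(x₀,h) + B(h,x₀) = Y_H − μ ∂ₛx₀` unrolls to a classical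
`τ`-periodic solution of the linearised problem forced by `(−μτ) ∂ₜu + H`. [folklore] -/
theorem forced_classical (hν : 0 < ν) (hτ : 0 < τ) (hsol : Torus.IsClassicalNSSolutionOn univ ν (fun _ => f) u p)
    (hper : Function.Periodic u τ) (hf0 : HasZeroMean f)
    (x₀ : W) (hx₀ : 𝐰 x₀ = 𝐬 (𝐨[τ, u]))
    {H : ℝ → UnitAddTorus (Fin 3) → EuclideanSpace ℝ (Fin 3)} (hH : IsSmoothSpaceTimeOn univ H) (hHper : Function.Periodic H τ)
    (hHdiv : ∀ t, IsDivFree (H t)) (hH0 : ∀ t, HasZeroMean (H t)) (YH : W) (hYH : 𝐰 YH = 𝐮[timeRoll τ H, 0])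
    (h : W) (μ : ℝ) (heqW : τ⁻¹ • Ds h + L₀ h + (B x₀ h + B h x₀) = (-μ) • Ds x₀ + YH) :
    ∃ w : ℝ → UnitAddTorus (Fin 3) → EuclideanSpace ℂ (Fin 3),
      w ∈ linPeriodicSol ν u τ (fun t x => ((((-μ : ℝ) : ℂ) * (τ : ℂ))) • velocityDot u t x + Torus.realToComplex (H t x)) := by
  have hU : IsSmooth (timeRoll τ u) := orbit_isSmooth hsol hper
  have hu0 := orbit_zero_modes hsol hper hf0
  have hut := orbit_transversal hsol hper
  obtain ⟨hHz, hHt, -, hHr⟩ := fieldFamily_admissible (τ := τ) (Z := H) hH hHper hHdiv hH0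
  have hVH : IsSmooth (timeRoll τ H) := isSmooth_timeRoll hH hHper
  have hHc : IsSmooth (complexify ∘ fun y => timeRoll τ H y - 0) :=
    (hVH.sub (isSmooth_const _)).comp_clm complexify.toContinuousLinearMap
  -- moments of the inhomogeneity
  have hyH : ∀ N : ℕ, ∑' m : ℤ × (Fin 3 → ℤ), ENNReal.ofReal ((Λ m) ^ N) * ‖(𝐮[timeRoll τ H, 0]) m‖ₑ ^ 2 ≠ ⊤ := by
    intro N
    have h1 := moments_of_rapidDecay (C := mFourierCoeff (complexify ∘ fun y => timeRoll τ H y - 0)) hHr N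
    exact ne_top_of_le_ne_top h1 (ENNReal.tsum_le_tsum fun m => by
      gcongr; exact enorm_le_enorm_sw (x := 𝐮[timeRoll τ H, 0]) hHz m)
  -- the right-hand side
  have hY : ∀ m, (𝐰 (((-μ) • Ds x₀ + YH : W))) m =
      ((-μ : ℝ) : ℂ) • ((2 * Real.pi * Complex.I * (m.1 : ℂ)) • 𝐨[τ, u] m) + 𝐮[timeRoll τ H, 0] m := fun m => by
    rw [coeW_add, Pi.add_apply, coe_smul_Ds_orbit hDs hsol hper hf0 x₀ hx₀ (-μ) m, hYH, Complex.ofReal_neg]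
  obtain ⟨heq, hhr⟩ := linear_core_forced hW hDs hL₀ hBf hν hτ hsol hper hf0 x₀ hx₀ h ((-μ) • Ds x₀ + YH)
    (b := ((-μ : ℝ) : ℂ)) (yH := 𝐮[timeRoll τ H, 0]) hyH hY heqW
  have hh0 : ∀ n : ℤ, (𝐜 (𝐰 h)) (n, 0) = 0 := cw_zero_mode (W_zero hW h)
  have hht : ∀ mm : ℤ × (Fin 3 → ℤ), (∑ jj : Fin 3, ((mm.2 jj : ℤ) : ℂ) * ((𝐜 (𝐰 h)) mm) jj) = 0 :=
    cw_transversal (W_trans hW h)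
  -- the Leray multiplier acts trivially on the (transversal) inhomogeneity
  have heq' : ∀ m : ℤ × (Fin 3 → ℤ), m.2 ≠ 0 →
      (2 * Real.pi * Complex.I * ((τ⁻¹ : ℝ) : ℂ) * (m.1 : ℂ) + ((4 * Real.pi ^ 2 * ν * freqNormSq m.2 : ℝ) : ℂ) +
          2 * Real.pi * Complex.I * (∑ jj : Fin 3, ((((∫ x, u 0 x) : EuclideanSpace ℝ (Fin 3)) jj : ℝ) : ℂ) * ((m.2 jj : ℤ) : ℂ))) •
          (𝐜 (𝐰 h)) m +
        Torus.lerayCoeff m.2 (𝐍[𝐨[τ, u], 𝐜 (𝐰 h)] m + 𝐍[𝐜 (𝐰 h), 𝐨[τ, u]] m) =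
        ((-μ : ℝ) : ℂ) • ((2 * Real.pi * Complex.I * (m.1 : ℂ)) • 𝐨[τ, u] m) +
          Torus.lerayCoeff m.2 (mFourierCoeff (complexify ∘ fun y => timeRoll τ H y - 0) (Fin.cons m.1 m.2)) := by
    intro m hm
    rw [heq m hm, SteadyLattice.lerayCoeff_of_kdot_eq_zero hm (hHt m)]
  have hH0' : ∀ n : ℤ, mFourierCoeff (complexify ∘ fun y => timeRoll τ H y - 0) (Fin.cons n (0 : Fin 3 → ℤ)) = 0 := fun n => hHz n
  obtain ⟨Q, hQ, hE⟩ := linear_rolledUp_of_coeff_forced (U := timeRoll τ u) (m₀ := ∫ x, u 0 x) (h := 𝐜 (𝐰 h))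
    (b := ((-μ : ℝ) : ℂ)) (Hc := complexify ∘ fun y => timeRoll τ H y - 0) hU hu0 hut hh0 hht hhr hHc hH0' heq'
  obtain ⟨hsw, hsq, hdivC, hmeanC, hperw, hEq⟩ := linear_classical_forced (ν := ν) hτ hsol.smooth_velocity hper
    hhr.isSmooth_fourierSynth hQ hE (div_synth_eq_zero (h := 𝐜 (𝐰 h)) hht hhr)
    (integral_timeSlice_synth_eq_zero (h := 𝐜 (𝐰 h)) hh0 hhr)
  refine ⟨_, hsw, hdivC, hmeanC, hperw, _, hsq, fun t x => ?_⟩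
  show _ = _ + ((((-μ : ℝ) : ℂ) * (τ : ℂ)) • velocityDot u t x + Torus.realToComplex (H t x))
  rw [hEq t x, Function.comp_apply, timeRoll_cons hHper, sub_zero, show τ * (τ⁻¹ * t) = t by field_simp,
    SteadyLattice.realToComplex_eq_complexify (H t x), add_assoc]
  rfl

omit hW hDs hL₀ hBf in
/-- **A steady admissible force as a space–time field**: `y_F = 𝐮[timeRoll τ (t ↦ F), 0]` (the coefficients of a
time-independent field live on the slice `n = 0`; the zero mode vanishes by the zero mean). [folklore] -/
theorem yf_eq_constField (τ : ℝ) {F : UnitAddTorus (Fin 3) → EuclideanSpace ℝ (Fin 3)} (hF : IsSmooth F) (hF0 : HasZeroMean F) :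
    𝐲 F = 𝐮[timeRoll τ (fun _ : ℝ => F), 0] := by
  funext m
  have e : (complexify ∘ fun y : UnitAddTorus (Fin 4) => timeRoll τ (fun _ : ℝ => F) y - 0) =
      fun y : UnitAddTorus (Fin 4) => (complexify ∘ F) (Fin.tail y) := by
    funext y; simp [timeRoll]
  rw [e, mFourierCoeff_comp_tail (continuous_complexify.comp hF.continuous) m.1 m.2]
  by_cases hm : m.2 = 0
  · simp only [hm, if_true]
    split_ifs
    · exact (SteadyLattice.mFourierCoeff_complexify_zero_of_hasZeroMean hF hF0).symm
    · rfl
  · simp only [hm, if_false]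

end Forced

/-! ## Registered part C (abstract, notation-free) -/

section Abstract

/-- **Registered sub-goal `lsFamilyPeriodic_partC`** (companion c3): COMPACTNESS OF THE BORDERED FREE-PERIOD LINEARISATION.  For
`T = J + K` with `K` compact, the operator `(h, μ) ↦ (Th + μ a, φ h)` is a compact perturbation of the linear homeomorphism
`J × id` of `E × ℝ` (pattern of `Literature.Analysis.Calculus.saddleNode_bordered_bijective`). [folklore] -/
theorem lsFamilyPeriodic_partC : ∀ (E : Type) [NormedAddCommGroup E] [NormedSpace ℝ E] (J : E ≃L[ℝ] E) (K : E →L[ℝ] E) (a : E) (φ : E →L[ℝ] ℝ), IsCompactOperator K → IsCompactOperator ((((((J : E →L[ℝ] E) + K).comp (ContinuousLinearMap.fst ℝ E ℝ) + (ContinuousLinearMap.snd ℝ E ℝ).smulRight a).prod (φ.comp (ContinuousLinearMap.fst ℝ E ℝ))) - ((J.prodCongr (ContinuousLinearEquiv.refl ℝ ℝ) : (E × ℝ) ≃L[ℝ] (E × ℝ)) : (E × ℝ) →L[ℝ] (E × ℝ)) : (E × ℝ) →L[ℝ] (E × ℝ))) := by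
  intro E _ _ J K a φ hKc
  set Th : (E × ℝ) →L[ℝ] (E × ℝ) :=
    ((((J : E →L[ℝ] E) + K).comp (ContinuousLinearMap.fst ℝ E ℝ) + (ContinuousLinearMap.snd ℝ E ℝ).smulRight a).prod
      (φ.comp (ContinuousLinearMap.fst ℝ E ℝ))) with hTh
  set Jh : (E × ℝ) ≃L[ℝ] (E × ℝ) := J.prodCongr (ContinuousLinearEquiv.refl ℝ ℝ) with hJh
  set A : E × ℝ →L[ℝ] E := K.comp (ContinuousLinearMap.fst ℝ E ℝ) + (ContinuousLinearMap.snd ℝ E ℝ).smulRight a with hA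
  set Bℝ : E × ℝ →L[ℝ] ℝ := φ.comp (ContinuousLinearMap.fst ℝ E ℝ) - ContinuousLinearMap.snd ℝ E ℝ with hB
  show IsCompactOperator ((Th - (Jh : (E × ℝ) →L[ℝ] (E × ℝ)) : (E × ℝ) →L[ℝ] (E × ℝ)))
  have hdecomp : ((Th - (Jh : (E × ℝ) →L[ℝ] (E × ℝ)) : (E × ℝ) →L[ℝ] (E × ℝ)) : E × ℝ → E × ℝ) =
      ((ContinuousLinearMap.inl ℝ E ℝ) ∘ (A : E × ℝ → E)) + ((ContinuousLinearMap.inr ℝ E ℝ) ∘ (Bℝ : E × ℝ → ℝ)) := by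
    funext q
    obtain ⟨h, μ⟩ := q
    have e1 : ((Th - (Jh : (E × ℝ) →L[ℝ] (E × ℝ)) : (E × ℝ) →L[ℝ] (E × ℝ)) : E × ℝ → E × ℝ) (h, μ) = Th (h, μ) - Jh (h, μ) := rfl
    rw [e1]
    simp only [hTh, hJh, ContinuousLinearEquiv.prodCongr_apply, ContinuousLinearEquiv.refl_apply, Pi.add_apply,
      Function.comp_apply, ContinuousLinearMap.inl_apply, ContinuousLinearMap.inr_apply, hA, hB,
      add_apply, sub_apply, ContinuousLinearMap.comp_apply, ContinuousLinearMap.prod_apply,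
      ContinuousLinearMap.coe_fst', ContinuousLinearMap.coe_snd', ContinuousLinearMap.smulRight_apply, Prod.mk_sub_mk,
      Prod.mk_add_mk, add_zero, zero_add, ContinuousLinearEquiv.coe_coe]
    refine Prod.ext ?_ ?_
    · simp only; abel
    · simp only
  have hAc : IsCompactOperator (A : E × ℝ → E) := by
    have h1 : IsCompactOperator (K.comp (ContinuousLinearMap.fst ℝ E ℝ) : E × ℝ → E) := hKc.comp_clm _
    have h2 : IsCompactOperator ((ContinuousLinearMap.snd ℝ E ℝ).smulRight a : E × ℝ → E) := by
      have hψc : IsCompactOperator ((ContinuousLinearMap.snd ℝ E ℝ) : E × ℝ → ℝ) :=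
        isCompactOperator_of_locallyCompactSpace_dom _
      have h := hψc.clm_comp (ContinuousLinearMap.toSpanSingleton ℝ a)
      have hfe : ((ContinuousLinearMap.toSpanSingleton ℝ a) ∘ ((ContinuousLinearMap.snd ℝ E ℝ) : E × ℝ → ℝ) : E × ℝ → E) =
          ((ContinuousLinearMap.snd ℝ E ℝ).smulRight a : E × ℝ → E) := by
        funext q; simp [ContinuousLinearMap.toSpanSingleton_apply]
      rwa [hfe] at h
    have h3 := h1.add h2
    have hfe : (K.comp (ContinuousLinearMap.fst ℝ E ℝ) : E × ℝ → E) + ((ContinuousLinearMap.snd ℝ E ℝ).smulRight a : E × ℝ → E) =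
        (A : E × ℝ → E) := by funext q; simp [hA]
    rwa [hfe] at h3
  have hBc : IsCompactOperator (Bℝ : E × ℝ → ℝ) := isCompactOperator_of_locallyCompactSpace_dom Bℝ
  have key := (hAc.clm_comp (ContinuousLinearMap.inl ℝ E ℝ)).add (hBc.clm_comp (ContinuousLinearMap.inr ℝ E ℝ))
  rw [← hdecomp] at key
  exact key

end Abstract

end Summit.AnomalousDissipation.AnomalousDissipation.Theorems.RobustLoudUpgrade.LsFamilyPeriodic

end
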